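import Literature.NumberTheory.LFunctions.Zhang2022.Section8Lemma84Contour
import Literature.NumberTheory.LFunctions.Zhang2022.Section10Lemma102Poles
import Literature.NumberTheory.LFunctions.Zhang2022.Section10Lemma102SmallRect0
import HarnessLib

/-!
# Zhang (2022), Lemma 10.2 — the contour argument for the shift-0 log-mean: an explicit bound in
# terms of bounds for the integrand on the contour

Topic `Literature/NumberTheory/LFunctions/Zhang2022` (Landau–Siegel audit tree; verdict-neutral).
Y. Zhang, *Discrete mean estimates and the Landau–Siegel zero*, arXiv:2211.02515v1 (2022)
[Zhang2022LandauSiegel] — **an unrefereed manuscript under adjudication**; DAG nodes `Z22:Lem10.2.pf`,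
`Z22:§10.u019/u021/u022`, `Z22:(8.9)` [Z22 p.56 tex L2824–L2851, p.46 tex L2392]. ZHANG-L
discharge lane (WP10); the `β_μ = 0` companion of sz-d27's `Section8Lemma84ContourBound`
(`Lemma84.norm_sum_log_sub_main_le`), assembled from the SAME generic contour pieces
(`Section8Lemma84Contour`: Perron (8.9) for logarithmic Riesz means shifted to `Re u = α`, the
rectangle decomposition, tails / left side / horizontal sides), sz-d43's shift-0 residue bookkeeping
`Lemma102.rect_big_eq_rect_small0` (poles `0` and `ρ̃ − 1`, both real) and the shift-0 small-rectangle
comparison `Lemma102.norm_rectSmall0_sub_main_le` (triple-pole model, residue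
`M₀(1 + (β_a+β_b)L + ½β_aβ_bL²)`).

Setting. `χ ≠ χ₀` mod `D`, `U` holomorphic on `Re s > 9/10`,
`Φ(u) = U(1+u)L(1+u+β_a,χ)L(1+u+β_b,χ)/L(1+u,χ)`, `x ≥ 1`, `0 < α ≤ η ≤ 1/40`, `T′ ≥ 1`; `ρ` a real
zero of `L(·,χ)` with `L′(ρ,χ) ≠ 0`, `1 − α/2 < ρ < 1`, the only zero with `Re w > 1 − 2η`,
`|Im w| < T′ + 1`; `f` with `∑|f(n)|n⁻⁹ < ∞` and `L(f, 9+it) = Φ(9+it)`; bounds `M_R` (`Re u ≥ α`, where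
also `L(1+u) ≠ 0`), `M_l` (left side `Re u = −η`, `|t| ≤ T′`), `M_h` (horizontal sides `|Im u| = T′`,
`−η ≤ Re u ≤ α`), and the model tolerance `Δ` on `∂([−α/2,α/2]×[−3α,3α])`. Conclusion
(`norm_sum_log_sub_main_le0`):
`‖Σ_{n≤x} f(n)log(x/n) − M₀(1 + (β_a+β_b)L + ½β_aβ_bL²)‖ ≤
  (2π)⁻¹(2e^{αL}M_R/T′ + e^{−ηL}M_lπ/η + 2(α+η)e^{αL}M_h/T′² + 56e^{αL/2}Δ/α)`, `L = log x`.

Nothing about the manuscript's Theorems 1–2 or about Landau–Siegel zeros is asserted.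

## References

* Y. Zhang, arXiv:2211.02515v1 (2022), §10 Lemma 10.2 (proof), §8 (8.9), Lemma 8.4 (proof).
  [cite: Zhang2022LandauSiegel, §10 Lemma 10.2]
* H. L. Montgomery, R. C. Vaughan, *Multiplicative Number Theory I*, CUP 2007, §5.1, §6.2.
  [cite: MontgomeryVaughan2007, §6.2]
-/

noncomputable section

open Complex Real Set MeasureTheory Filter Topology

namespace Literature.NumberTheory.LFunctions.Zhang2022.Lemma102

open Literature.Analysis.Complex

section ContourBound0

variable {D : ℕ} [NeZero D] (χ : DirichletCharacter ℂ D)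
variable (U Φ : ℂ → ℂ) (f : ℕ → ℂ) (M₀ βa βb : ℂ)
variable {x ρ η α T' M_R M_l M_h Δ : ℝ}

/-- `‖(1/(2π) : ℂ)‖ = 1/(2π)` and `‖I/(2π)‖ = 1/(2π)`. [folklore] -/
private theorem norm_inv_two_pi0 :
    ‖(1 / (2 * π) : ℂ)‖ = 1 / (2 * π) ∧ ‖(I / (2 * π) : ℂ)‖ = 1 / (2 * π) := by
  have h2π : ‖(2 * π : ℂ)‖ = 2 * π := by
    rw [norm_mul, Complex.norm_ofNat, Complex.norm_real, Real.norm_of_nonneg Real.pi_pos.le]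
  constructor
  · rw [norm_div, norm_one, h2π]
  · rw [norm_div, Complex.norm_I, h2π]

/-- The hypothesis `Φ(u) = U(1+u)L(1+u+β_a)L(1+u+β_b)/L(1+u)` in the `1 − β_μ + u` form (`β_μ = 0`)
consumed by the generic `Section8Lemma84*` lemmas. [cite: Zhang2022LandauSiegel, §8 (8.9)] -/
theorem hPhi_shift0'
    (hΦ : ∀ u, Φ u = U (1 + u) * χ.LFunction (1 + u + βa) * χ.LFunction (1 + u + βb) /
      χ.LFunction (1 + u)) :
    ∀ u, Φ u = U (1 - 0 + u) * χ.LFunction (1 - 0 + u + βa) * χ.LFunction (1 - 0 + u + βb) /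
      χ.LFunction (1 - 0 + u) := by
  intro u; rw [sub_zero]; exact hΦ u

/-- **The contour argument of Lemma 10.2 (shift `β_μ = 0`) with explicit pieces.** See the module
docstring for the setting; the conclusion is
`‖∑_{n≤x} f(n)log(x/n) − M₀(1 + (β_a+β_b)L + ½β_aβ_bL²)‖ ≤
  (2π)⁻¹(2e^{αL}M_R/T′ + e^{−ηL}M_lπ/η + 2(α+η)e^{αL}M_h/T′² + 56e^{αL/2}Δ/α)`, `L = log x`.
[cite: Zhang2022LandauSiegel, §10 Lemma 10.2 (proof) and §8 (8.9)] [cite: MontgomeryVaughan2007, §6.2] -/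
theorem norm_sum_log_sub_main_le0 (hχ1 : χ ≠ 1)
    (hUd : DifferentiableOn ℂ U {s : ℂ | 9 / 10 < s.re})
    (hΦ : ∀ u, Φ u = U (1 + u) * χ.LFunction (1 + u + βa) * χ.LFunction (1 + u + βb) /
      χ.LFunction (1 + u))
    (hx : 1 ≤ x) (hα : 0 < α) (hαη : α ≤ η) (hη : η ≤ 1 / 40) (hT : 1 ≤ T')
    (hρ1 : ρ < 1) (hρα : 1 - α / 2 < ρ) (hLρ : χ.LFunction ρ = 0)
    (hL'ρ : deriv χ.LFunction ρ ≠ 0)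
    (hzf : ∀ w : ℂ, 1 - 2 * η < w.re → |w.im| < T' + 1 → w ≠ ρ → χ.LFunction w ≠ 0)
    (hf : LSeriesSummable f 9) (hfΦ : ∀ t : ℝ, LSeries f ((9 : ℝ) + t * I) = Φ ((9 : ℝ) + t * I))
    (hMR0 : 0 ≤ M_R) (hPhiR : ∀ u : ℂ, α ≤ u.re → χ.LFunction (1 + u) ≠ 0 ∧ ‖Φ u‖ ≤ M_R)
    (hMl0 : 0 ≤ M_l) (hPhiL : ∀ t : ℝ, |t| ≤ T' → ‖Φ (((-η : ℝ) : ℂ) + t * I)‖ ≤ M_l)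
    (hMh0 : 0 ≤ M_h)
    (hPhiH : ∀ x' y' : ℝ, -η ≤ x' → x' ≤ α → |y'| = T' → ‖Φ ((x' : ℂ) + y' * I)‖ ≤ M_h)
    (hΔ : ∀ u : ℂ, u.re ∈ Icc (-(α / 2)) (α / 2) → u.im ∈ Icc (-(3 * α)) (3 * α) →
      (|u.re| = α / 2 ∨ |u.im| = 3 * α) →
      ‖Φ u - M₀ * (u + βa) * (u + βb) / u‖ ≤ Δ) :
    ‖(∑ n ∈ Finset.Ioc 0 ⌊x⌋₊, f n * (Real.log (x / n) : ℂ)) -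
        M₀ * (1 + (βa + βb) * (Real.log x : ℂ) + βa * βb * (Real.log x : ℂ) ^ 2 / 2)‖ ≤
      1 / (2 * π) * (2 * (Real.exp (α * Real.log x) * M_R / T') +
        Real.exp (-η * Real.log x) * M_l * (π / η) +
        2 * ((α + η) * (Real.exp (α * Real.log x) * M_h / T' ^ 2)) +
        56 * Real.exp (α * Real.log x / 2) * Δ / α) := by
  have hx0 : 0 < x := by linarith
  have hLx : 0 ≤ Real.log x := Real.log_nonneg hx
  have hη0 : 0 < η := lt_of_lt_of_le hα hαη
  have hΦ0 := hPhi_shift0' χ U Φ βa βb hΦ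
  have e10 : ∀ u : ℂ, (1 : ℂ) - 0 + u = 1 + u := fun u => by rw [sub_zero]
  -- the integrand `E(u) = e^{uL}Φ(u)/u²`
  set E : ℂ → ℂ := fun u => cexp (u * (Real.log x : ℂ)) * Φ u / u ^ 2 with hE
  have hEu : ∀ u, E u = cexp (u * (Real.log x : ℂ)) * Φ u / u ^ 2 := fun u => rfl
  -- differentiability of `Φ` to the right of `Re u = α`
  have hΦdiff : ∀ u : ℂ, α ≤ u.re → DifferentiableAt ℂ Φ u := fun u hu =>
    Lemma84.differentiableAt_Phi χ U Φ 0 βa βb hχ1 hUd (by simp) hΦ0 (by linarith)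
      (by rw [e10]; exact (hPhiR u hu).1)
  have hΦd : DifferentiableOn ℂ Φ (re ⁻¹' Icc α 9) := fun u hu =>
    (hΦdiff u hu.1).differentiableWithinAt
  -- Perron at `Re u = 9`, shifted to `Re u = α`
  have hP := Lemma84.sum_log_eq_integral_shift (f := f) hx hα (by linarith : α ≤ (9 : ℝ)) hf hΦd hfΦ
    (M := M_R) (fun u h1 _ => (hPhiR u h1).2)
  -- integrability on `Re u = α`
  have hcont : Continuous fun t : ℝ => Φ ((α : ℂ) + t * I) := by
    have hline : Continuous fun t : ℝ => (α : ℂ) + t * I := by fun_prop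
    exact continuous_iff_continuousAt.2 fun t =>
      ((hΦdiff _ (by simp)).continuousAt).comp hline.continuousAt
  have hint : Integrable fun t : ℝ => E ((α : ℂ) + t * I) :=
    Lemma84.integrable_line (L := Real.log x) hα hcont (fun t => (hPhiR _ (by simp)).2)
  -- the rectangle decomposition of the shifted line
  have hdec := Lemma84.integral_line_decomp (Θ := E) (σ₀ := α) (σ₁ := η) (T := T') hint
  -- the residue bookkeeping: big rectangle = small rectangle
  have hRR := rect_big_eq_rect_small0 χ U Φ E βa βb (Real.log x : ℂ) ρ η α T' hχ1 hUd hΦ hEu hαη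
    hη hT hρ1 hρα hLρ hL'ρ hzf
  -- the small rectangle against the model
  have hGc : ∀ u : ℂ, u.re ∈ Icc (-(α / 2)) (α / 2) →
      u.im ∈ Icc (-(3 * α)) (3 * α) → (|u.re| = α / 2 ∨ |u.im| = 3 * α) →
      ContinuousAt E u := by
    intro u hre him hb
    obtain ⟨hnorm, -, hu0⟩ := bdry_facts0 hα hre hb
    have hLne : χ.LFunction (1 - 0 + u) ≠ 0 := by
      rw [e10]
      refine hzf _ ?_ ?_ ?_
      · simp only [add_re, one_re]; linarith [hre.1]
      · have : (1 + u).im = u.im := by simp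
        rw [this, abs_lt]; constructor <;> linarith [him.1, him.2]
      · intro h
        have hure : u.re = ρ - 1 := by
          have := congrArg Complex.re h
          simp only [add_re, one_re, Complex.ofReal_re] at this
          linarith
        have huim : u.im = 0 := by
          have := congrArg Complex.im h
          simp only [add_im, one_im, Complex.ofReal_im] at this
          linarith
        rcases hb with h' | h'
        · rw [hure] at h'
          rcases (abs_eq (by positivity : (0 : ℝ) ≤ α / 2)).1 h' with h'' | h'' <;> linarith
        · rw [huim, abs_zero] at h'; linarith
    have hd := Lemma84.differentiableAt_Phi χ U Φ 0 βa βb hχ1 hUd (by simp) hΦ0 (u := u)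
      (by linarith [hre.1]) hLne
    exact (Lemma84.differentiableAt_G Φ E (Real.log x : ℂ) hEu hd hu0).continuousAt
  have hsmall := norm_rectSmall0_sub_main_le (M₀ := M₀) (βa := βa) (βb := βb) hα hLx hEu hΔ hGc
  -- the bounds for the pieces
  have htails := Lemma84.norm_tails_le (Φ := Φ) (L := Real.log x) hα hT hMR0
    (fun t _ => (hPhiR _ (by simp)).2)
  have hleft := Lemma84.norm_left_le (Φ := Φ) (L := Real.log x) (T := T') hη0 (by linarith) hMl0 hPhiL
  have hB : ∀ (y' : ℝ) (_ : |y'| = T') (u : ℝ), -η ≤ u → u ≤ α →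
      ‖E ((u : ℂ) + (y' : ℂ) * I)‖ ≤ Real.exp (α * Real.log x) * M_h / T' ^ 2 := by
    intro y' hy' u hu1 hu2
    have hsq : u ^ 2 + y' ^ 2 ≠ 0 := by
      have : y' ^ 2 = T' ^ 2 := by rw [← sq_abs, hy']
      nlinarith
    have h := Lemma84.norm_G_line_le (L := Real.log x) (σ := u) (t := y') (hPhiH u y' hu1 hu2 hy') hsq
    rw [hEu]
    refine h.trans ?_
    have hT2 : T' ^ 2 ≤ u ^ 2 + y' ^ 2 := by
      have : y' ^ 2 = T' ^ 2 := by rw [← sq_abs, hy']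
      nlinarith
    have hnum : Real.exp (u * Real.log x) * M_h ≤ Real.exp (α * Real.log x) * M_h :=
      mul_le_mul_of_nonneg_right (Real.exp_le_exp.2 (mul_le_mul_of_nonneg_right hu2 hLx)) hMh0
    exact div_le_div₀ (by positivity) hnum (by positivity) hT2
  have hbot := Lemma84.norm_horizontal_le (Θ := E) (σ₀ := α) (σ₁ := η) (T' := -T')
    (B := Real.exp (α * Real.log x) * M_h / T' ^ 2) (by linarith)
    (hB (-T') (by rw [abs_neg, abs_of_pos (by linarith)]))
  have htop := Lemma84.norm_horizontal_le (Θ := E) (σ₀ := α) (σ₁ := η) (T' := T')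
    (B := Real.exp (α * Real.log x) * M_h / T' ^ 2) (by linarith)
    (hB T' (abs_of_pos (by linarith)))
  -- names for the pieces
  set T₁ : ℂ := ∫ t in Iic (-T'), E ((α : ℂ) + t * I) with hT₁
  set T₂ : ℂ := ∫ t in Ioi T', E ((α : ℂ) + t * I) with hT₂
  set Lf : ℂ := ∫ t in (-T')..T', E (((-η : ℝ) : ℂ) + t * I) with hLf
  set Bo : ℂ := ∫ u in (-η)..α, E (u + ((-T' : ℝ) : ℂ) * I) with hBo
  set Tp : ℂ := ∫ u in (-η)..α, E (u + (T' : ℂ) * I) with hTp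
  set Rs : ℂ := rectBoundaryIntegral E (-(α / 2)) (α / 2) (-(3 * α)) (3 * α) with hRs
  set X : ℂ := M₀ * (1 + (βa + βb) * (Real.log x : ℂ) + βa * βb * (Real.log x : ℂ) ^ 2 / 2) with hX
  have hS : (∑ n ∈ Finset.Ioc 0 ⌊x⌋₊, f n * (Real.log (x / n) : ℂ)) =
      (1 / (2 * π) : ℂ) * (T₁ + T₂ + Lf + I * Bo - I * Tp - I * Rs) := by
    rw [hP]
    congr 1
    rw [← hRR, ← hdec]
  have key : (∑ n ∈ Finset.Ioc 0 ⌊x⌋₊, f n * (Real.log (x / n) : ℂ)) - X =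
      (1 / (2 * π) : ℂ) * (T₁ + T₂ + Lf + I * Bo - I * Tp) -
        (I / (2 * π)) * (Rs - 2 * π * I * X) := by
    rw [hS]
    have hπ : (π : ℂ) ≠ 0 := by exact_mod_cast Real.pi_ne_zero
    field_simp
    linear_combination (-(2 : ℂ) * π * X) * I_sq
  obtain ⟨n1, n2⟩ := norm_inv_two_pi0
  have hπ0 : 0 < 1 / (2 * π) := by positivity
  rw [key]
  -- norms of the pieces
  have hnT : ‖T₂‖ + ‖T₁‖ ≤ 2 * (Real.exp (α * Real.log x) * M_R / T') := htails
  have hnL : ‖Lf‖ ≤ Real.exp (-η * Real.log x) * M_l * (π / η) := hleft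
  have hnBo : ‖Bo‖ ≤ (α + η) * (Real.exp (α * Real.log x) * M_h / T' ^ 2) := hbot
  have hnTp : ‖Tp‖ ≤ (α + η) * (Real.exp (α * Real.log x) * M_h / T' ^ 2) := htop
  have hnRs : ‖Rs - 2 * π * I * X‖ ≤ 56 * Real.exp (α * Real.log x / 2) * Δ / α := hsmall
  calc ‖(1 / (2 * π) : ℂ) * (T₁ + T₂ + Lf + I * Bo - I * Tp) - (I / (2 * π)) * (Rs - 2 * π * I * X)‖
      ≤ ‖(1 / (2 * π) : ℂ) * (T₁ + T₂ + Lf + I * Bo - I * Tp)‖ +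
          ‖(I / (2 * π)) * (Rs - 2 * π * I * X)‖ := norm_sub_le _ _
    _ = 1 / (2 * π) * ‖T₁ + T₂ + Lf + I * Bo - I * Tp‖ +
          1 / (2 * π) * ‖Rs - 2 * π * I * X‖ := by rw [norm_mul, norm_mul, n1, n2]
    _ ≤ 1 / (2 * π) * (‖T₁‖ + ‖T₂‖ + ‖Lf‖ + ‖Bo‖ + ‖Tp‖) +
          1 / (2 * π) * ‖Rs - 2 * π * I * X‖ := by
        gcongr
        calc ‖T₁ + T₂ + Lf + I * Bo - I * Tp‖
            ≤ ‖T₁ + T₂ + Lf + I * Bo‖ + ‖I * Tp‖ := norm_sub_le _ _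
          _ ≤ (‖T₁ + T₂ + Lf‖ + ‖I * Bo‖) + ‖I * Tp‖ := by gcongr; exact norm_add_le _ _
          _ ≤ ((‖T₁ + T₂‖ + ‖Lf‖) + ‖I * Bo‖) + ‖I * Tp‖ := by gcongr; exact norm_add_le _ _
          _ ≤ (((‖T₁‖ + ‖T₂‖) + ‖Lf‖) + ‖I * Bo‖) + ‖I * Tp‖ := by gcongr; exact norm_add_le _ _
          _ = ‖T₁‖ + ‖T₂‖ + ‖Lf‖ + ‖Bo‖ + ‖Tp‖ := by
              rw [norm_mul, norm_mul, Complex.norm_I, one_mul, one_mul]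
    _ ≤ 1 / (2 * π) * (2 * (Real.exp (α * Real.log x) * M_R / T') +
          Real.exp (-η * Real.log x) * M_l * (π / η) +
          2 * ((α + η) * (Real.exp (α * Real.log x) * M_h / T' ^ 2))) +
          1 / (2 * π) * (56 * Real.exp (α * Real.log x / 2) * Δ / α) := by
        have hsum : ‖T₁‖ + ‖T₂‖ + ‖Lf‖ + ‖Bo‖ + ‖Tp‖ ≤
            2 * (Real.exp (α * Real.log x) * M_R / T') +
              Real.exp (-η * Real.log x) * M_l * (π / η) +
              2 * ((α + η) * (Real.exp (α * Real.log x) * M_h / T' ^ 2)) := by linarith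
        exact add_le_add (mul_le_mul_of_nonneg_left hsum hπ0.le)
          (mul_le_mul_of_nonneg_left hnRs hπ0.le)
    _ = _ := by ring

end ContourBound0

end Literature.NumberTheory.LFunctions.Zhang2022.Lemma102
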